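import Summits.HubbardSuperconductivity.HubbardSuperconductivity.Theorems.CooperPairDMottWalkPlaquetteGramCert
import HarnessLib

/-!
# Ventures/CertifiedQuantumChemistry — Rows/SymmetryBlocks.lean: symmetry-blocked Gram certificates (typer aside T-06b)

HONEST FRAMING (verbatim): certified bounds for a stated model Hamiltonian in a stated basis; not a
claim about the real molecule beyond that model.

A kernel-checked positivity certificate `ddCheckP` (`…CooperPairDMottWalkPlaquetteGramCert`) for an
integer quadratic form on `n` indices costs a dense `n × n` integer factor — fine at `n = 36` (the `L = 4`
ring, `Certificates/HubbardRingL4Kernel.lean`), hopeless as a literal at `n = 400` (the `L = 6` ring). This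
file proves the standard SYMMETRY REDUCTION (Gatermann–Parrilo, J. Pure Appl. Algebra 192 (2004) §3;
Serre, *Linear Representations of Finite Groups* §2.6 — here only for the elementary abelian group
`(ℤ/2)^4`, where everything is a sign) in the concrete form the kernel can evaluate:

* a SIGNED MAP `g = (π, ε)` acts on real vectors by `(g • x) a = ε a · x (π a)`; `isInvol g` (`π` an
  involution, `ε (π a) = ε a = ±1`), `preserves g B` (`B (π a) (π b) ε a ε b = B a b`) and `comm g h` are
  BOOLEAN checks on a finite index type (decided by the kernel on tables, `decide +kernel`);
* for such a symmetry `4 Q(x) = Q(x + g•x) + Q(x − g•x)` (`zform_split`), so for four symmetries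
  `g₀…g₃` positivity of `Q` follows from positivity on the images of the sixteen operators
  `P_b = (1 + s₀g₀)(1 + s₁g₁)(1 + s₂g₂)(1 + s₃g₃)`, `sᵢ = ±1` (`nonneg_of_blocks4`; no commutation needed);
* for pairwise COMMUTING symmetries, `Q(P_b x, P_b x)` is the quadratic form of the small INTEGER matrix
  `blockMat` (`C k l = 16 Σ_w Pcoef w r_l · B r_k (Pimg w r_l)`, `w ∈ Bool⁴` the sixteen group words,
  `r_k` representatives of the LIVE orbits) in orbit-summed coordinates (`block_nonneg`): every index is a
  word image of its orbit representative (`hword`, decidable), `P_b e_{Pimg w r} = Pcoef w r • P_b e_r`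
  (`P4_single_img`), and an orbit on which some stabilising word has coefficient `−1` is annihilated
  (`hlive`, decidable). Hence sixteen passing `ddCheckP (blockMat …) G_b σ_b` prove `Q ≥ 0`.
* `preserves_bMatP_prod` / `preserves_bMatP_swap`: the two shapes of symmetry of the two-species sector
  matrix `bMatP` (a signed product of one-species table symmetries; the species swap), reduced to
  invariance of the one-species tables (decidable, `p²` checks instead of `(pq)²`).

Part 1 of 3 (`Rows/SymmetryBlockWords.lean`, `Rows/SymmetryBlockTables.lean` continue). Generic in the index type and the integer matrix; the `L = 6` instance (generators half-translation,
reflection, species swap, particle–hole; 44 orbits) is `Rows/HubbardRingL6Symmetry.lean` and the per-`U`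
Gram data `Certificates/HubbardRingL6KernelLowerU*.lean`. 0 `sorry`, no `Prop`-valued definitions (the three
predicates are `Bool`-valued checks). Typer `pub-qchem-typer` (gen 3), 0 core-h.
-/

namespace Summit.Ventures.CertifiedQuantumChemistry

open Matrix Finset
open Summit.HubbardSuperconductivity.HubbardSuperconductivity.Theorems.CooperPairDMottWalk

namespace SymmetryBlocks

variable {ι : Type*} [Fintype ι] [DecidableEq ι]

/-! ## The real bilinear form of an integer matrix -/

/-- The real bilinear form `Q(x, y) = Σ_{a,b} x_a B_{ab} y_b` of an integer matrix. [folklore] -/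
noncomputable def zform (B : ι → ι → ℤ) : (ι → ℝ) →ₗ[ℝ] (ι → ℝ) →ₗ[ℝ] ℝ :=
  Matrix.toBilin' (Matrix.of fun a b => (B a b : ℝ))

/-- Entrywise formula for `zform`. -/
theorem zform_apply (B : ι → ι → ℤ) (x y : ι → ℝ) :
    zform B x y = ∑ a, ∑ b, x a * (B a b : ℝ) * y b := by
  rw [zform, Matrix.toBilin'_apply]; rfl

/-- `zform` on basis vectors is the matrix entry. -/
theorem zform_single (B : ι → ι → ℤ) (a b : ι) :
    zform B (Pi.single a 1) (Pi.single b 1) = (B a b : ℝ) := by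
  rw [zform, Matrix.toBilin'_single]; rfl

/-! ## Signed maps -/

/-- A signed map on the index set: `a ↦ π a` carrying a sign `ε a`. [folklore] -/
structure SgnMap (ι : Type*) where
  /-- the index map -/
  π : ι → ι
  /-- the sign -/
  ε : ι → ℤ

namespace SgnMap

variable (g h : SgnMap ι)

/-- Action on vectors: `(g • x) a = ε a · x (π a)`. [folklore] -/
noncomputable def act (x : ι → ℝ) : ι → ℝ := fun a => (g.ε a : ℝ) * x (g.π a)

omit [Fintype ι] [DecidableEq ι] in
/-- The action is additive. -/
theorem act_add (x y : ι → ℝ) : g.act (x + y) = g.act x + g.act y := by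
  funext a; simp [act, mul_add]

omit [Fintype ι] [DecidableEq ι] in
/-- The action commutes with scalars. -/
theorem act_smul (c : ℝ) (x : ι → ℝ) : g.act (c • x) = c • g.act x := by
  funext a; simp only [act, Pi.smul_apply, smul_eq_mul]; ring

omit [Fintype ι] [DecidableEq ι] in
/-- The action commutes with finite sums. -/
theorem act_sum {κ : Type*} (S : Finset κ) (x : κ → ι → ℝ) :
    g.act (∑ j ∈ S, x j) = ∑ j ∈ S, g.act (x j) := by
  funext a; simp [act, Finset.mul_sum]

/-- Signed INVOLUTION check: `π (π a) = a`, `ε (π a) = ε a`, `ε a · ε a = 1` (Boolean, kernel-decidable). [folklore] -/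
def isInvol : Bool :=
  decide ((∀ a, g.π (g.π a) = a) ∧ (∀ a, g.ε (g.π a) = g.ε a) ∧ ∀ a, g.ε a * g.ε a = 1)

/-- `g` preserves the integer matrix `B` (Boolean check): `B (π a) (π b) · ε a · ε b = B a b`. [folklore] -/
def preserves (B : ι → ι → ℤ) : Bool := decide (∀ a b, B (g.π a) (g.π b) * (g.ε a * g.ε b) = B a b)

/-- Two signed maps commute as actions on vectors (Boolean check). [folklore] -/
def comm : Bool :=
  decide ((∀ a, h.π (g.π a) = g.π (h.π a)) ∧ ∀ a, g.ε a * h.ε (g.π a) = h.ε a * g.ε (h.π a))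

variable {g h}

/-- An involution: `π (π a) = a`. -/
theorem pi_pi (hg : g.isInvol = true) (a : ι) : g.π (g.π a) = a := (of_decide_eq_true hg).1 a
/-- Signs are `π`-invariant. -/
theorem eps_pi (hg : g.isInvol = true) (a : ι) : g.ε (g.π a) = g.ε a := (of_decide_eq_true hg).2.1 a
/-- Signs square to one. -/
theorem eps_sq (hg : g.isInvol = true) (a : ι) : g.ε a * g.ε a = 1 := (of_decide_eq_true hg).2.2 a
omit [DecidableEq ι] in
/-- The preserved-matrix identity. -/
theorem preserves_eq {B : ι → ι → ℤ} (hB : g.preserves B = true) (a b : ι) :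
    B (g.π a) (g.π b) * (g.ε a * g.ε b) = B a b := of_decide_eq_true hB a b
/-- Commuting index maps. -/
theorem pi_comm (hc : g.comm h = true) (a : ι) : h.π (g.π a) = g.π (h.π a) := (of_decide_eq_true hc).1 a
/-- Commuting sign cocycles. -/
theorem eps_comm (hc : g.comm h = true) (a : ι) :
    g.ε a * h.ε (g.π a) = h.ε a * g.ε (h.π a) := (of_decide_eq_true hc).2 a

/-- An involution acts by an involution. -/
theorem act_act (hg : g.isInvol = true) (x : ι → ℝ) : g.act (g.act x) = x := by
  funext a
  simp only [act]
  rw [eps_pi hg a, pi_pi hg a, ← mul_assoc, ← Int.cast_mul, eps_sq hg a, Int.cast_one, one_mul]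

/-- Commuting signed maps act by commuting operators. -/
theorem act_comm (hc : g.comm h = true) (x : ι → ℝ) : g.act (h.act x) = h.act (g.act x) := by
  funext a
  simp only [act]
  rw [pi_comm hc a, ← mul_assoc, ← mul_assoc, ← Int.cast_mul, ← Int.cast_mul, eps_comm hc a]

/-- `g • (c e_t) = (c ε t) e_{π t}` for an involution. -/
theorem act_single (hg : g.isInvol = true) (t : ι) (c : ℝ) :
    g.act (c • Pi.single t (1 : ℝ)) = (c * g.ε t) • Pi.single (g.π t) (1 : ℝ) := by
  funext a
  simp only [act, Pi.smul_apply, smul_eq_mul, Pi.single_apply]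
  by_cases h : a = g.π t
  · subst h
    rw [pi_pi hg t, if_pos rfl, if_pos rfl, eps_pi hg t]; ring
  · have h' : g.π a ≠ t := fun h2 => h (by rw [← h2, pi_pi hg a])
    rw [if_neg h', if_neg h]; ring

/-- The bijection underlying an involution. -/
def toPerm (hg : g.isInvol = true) : ι ≃ ι := ⟨g.π, g.π, pi_pi hg, pi_pi hg⟩

/-- A symmetry preserves the form. -/
theorem zform_act_act {B : ι → ι → ℤ} (hg : g.isInvol = true) (hB : g.preserves B = true) (x y : ι → ℝ) :
    zform B (g.act x) (g.act y) = zform B x y := by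
  rw [zform_apply, zform_apply]
  symm
  calc ∑ a, ∑ b, x a * (B a b : ℝ) * y b
      = ∑ a, ∑ b, x (g.π a) * (B (g.π a) (g.π b) : ℝ) * y (g.π b) := by
        rw [← (toPerm hg).sum_comp]
        refine Finset.sum_congr rfl fun a _ => ?_
        rw [← (toPerm hg).sum_comp]
        rfl
    _ = ∑ a, ∑ b, g.act x a * (B a b : ℝ) * g.act y b := by
        refine Finset.sum_congr rfl fun a _ => Finset.sum_congr rfl fun b _ => ?_
        simp only [act]
        have hab : (B (g.π a) (g.π b) : ℝ) * ((g.ε a : ℝ) * g.ε b) = B a b := by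
          exact_mod_cast preserves_eq hB a b
        have ha : (g.ε a : ℝ) * g.ε a = 1 := by exact_mod_cast eps_sq hg a
        have hb : (g.ε b : ℝ) * g.ε b = 1 := by exact_mod_cast eps_sq hg b
        rw [← hab]
        linear_combination (-(x (g.π a) * (B (g.π a) (g.π b) : ℝ) * y (g.π b)) *
            ((g.ε b : ℝ) * g.ε b)) * ha - (x (g.π a) * (B (g.π a) (g.π b) : ℝ) * y (g.π b)) * hb

/-- Hence `g` is self-adjoint for the form. -/
theorem zform_act_left {B : ι → ι → ℤ} (hg : g.isInvol = true) (hB : g.preserves B = true) (x y : ι → ℝ) :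
    zform B (g.act x) y = zform B x (g.act y) := by
  rw [← zform_act_act hg hB (g.act x) y, act_act hg]

/-! ## The projector steps `x ↦ x + s • g x` -/

/-- `pstep g s x = x + s • (g • x)` (for `s = ±1`, twice the projector onto the `g = s` eigenspace). [folklore] -/
noncomputable def pstep (g : SgnMap ι) (s : ℝ) (x : ι → ℝ) : ι → ℝ := x + s • g.act x

omit [Fintype ι] [DecidableEq ι] in
/-- `pstep` is additive. -/
theorem pstep_add (s : ℝ) (x y : ι → ℝ) : pstep g s (x + y) = pstep g s x + pstep g s y := by
  simp only [pstep, act_add, smul_add]; abel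

omit [Fintype ι] [DecidableEq ι] in
/-- `pstep` commutes with scalars. -/
theorem pstep_smul (s c : ℝ) (x : ι → ℝ) : pstep g s (c • x) = c • pstep g s x := by
  simp only [pstep, act_smul, smul_add, smul_comm c s]

omit [Fintype ι] [DecidableEq ι] in
/-- `pstep` commutes with finite sums. -/
theorem pstep_sum {κ : Type*} (s : ℝ) (S : Finset κ) (x : κ → ι → ℝ) :
    pstep g s (∑ j ∈ S, x j) = ∑ j ∈ S, pstep g s (x j) := by
  simp only [pstep, act_sum, Finset.smul_sum, Finset.sum_add_distrib]

/-- `4 Q(x) = Q(x + g x) + Q(x − g x)` for a symmetry `g` of `Q`. -/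
theorem zform_split {B : ι → ι → ℤ} (hg : g.isInvol = true) (hB : g.preserves B = true) (x : ι → ℝ) :
    4 * zform B x x =
      zform B (pstep g 1 x) (pstep g 1 x) + zform B (pstep g (-1) x) (pstep g (-1) x) := by
  have h1 := zform_act_act hg hB x x
  simp only [pstep, one_smul, neg_smul, map_add, map_neg, LinearMap.add_apply,
    LinearMap.neg_apply, h1]
  ring

/-- `g (pstep g s y) = s • pstep g s y` (`s = ±1`). -/
theorem act_pstep (hg : g.isInvol = true) {s : ℝ} (hs : s * s = 1) (y : ι → ℝ) :
    g.act (pstep g s y) = s • pstep g s y := by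
  simp only [pstep, act_add, act_smul, act_act hg, smul_add, smul_smul, hs, one_smul]; abel

/-- `pstep g s (g y) = s • pstep g s y` (`s = ±1`). -/
theorem pstep_act_self (hg : g.isInvol = true) {s : ℝ} (hs : s * s = 1) (y : ι → ℝ) :
    pstep g s (g.act y) = s • pstep g s y := by
  simp only [pstep, act_act hg, smul_add, smul_smul, hs, one_smul]; abel

/-- `pstep g s` passes a commuting `h`. -/
theorem pstep_act_comm (hc : g.comm h = true) (s : ℝ) (y : ι → ℝ) :
    pstep g s (h.act y) = h.act (pstep g s y) := by
  simp only [pstep, act_add, act_smul, act_comm hc]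

/-- Commuting steps commute. -/
theorem pstep_comm (hc : g.comm h = true) (s t : ℝ) (y : ι → ℝ) :
    pstep g s (pstep h t y) = pstep h t (pstep g s y) := by
  simp only [pstep, act_add, act_smul, act_comm hc, smul_add, smul_smul, mul_comm s t]; abel

/-- `pstep g s` is self-adjoint for the form. -/
theorem zform_pstep_left {B : ι → ι → ℤ} (hg : g.isInvol = true) (hB : g.preserves B = true) (s : ℝ)
    (x y : ι → ℝ) : zform B (pstep g s x) y = zform B x (pstep g s y) := by
  simp only [pstep, map_add, map_smul, LinearMap.add_apply, LinearMap.smul_apply,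
    zform_act_left hg hB, smul_eq_mul]

/-- `pstep g s ∘ pstep g s = 2 • pstep g s` (`s = ±1`). -/
theorem pstep_pstep (hg : g.isInvol = true) {s : ℝ} (hs : s * s = 1) (y : ι → ℝ) :
    pstep g s (pstep g s y) = (2 : ℝ) • pstep g s y := by
  have h := act_pstep hg hs y
  unfold pstep at h ⊢
  rw [h, smul_smul, hs, one_smul, two_smul]

/-- One step on a weighted basis vector: `pstep g s (c • e_t) = c • e_t + (s c ε t) • e_{π t}`. -/
theorem pstep_single (hg : g.isInvol = true) (s c : ℝ) (t : ι) :
    pstep g s (c • Pi.single t (1 : ℝ)) =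
      c • Pi.single t (1 : ℝ) + (s * (c * g.ε t)) • Pi.single (g.π t) (1 : ℝ) := by
  rw [pstep, act_single hg, smul_smul]

end SgnMap

open SgnMap

/-! ## Signs and words -/

/-- `±1 : ℝ` from a Boolean (`true ↦ 1`). -/
noncomputable def sgnR : Bool → ℝ
  | true => 1
  | false => -1

/-- `±1 : ℤ` from a Boolean (`true ↦ 1`). -/
def sgnZ : Bool → ℤ
  | true => 1
  | false => -1

/-- `sgnR` is the cast of `sgnZ`. -/
theorem sgnR_eq_cast (b : Bool) : sgnR b = ((sgnZ b : ℤ) : ℝ) := by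
  cases b <;> simp [sgnR, sgnZ]

/-- `sgnR b` squares to one. -/
theorem sgnR_mul_self (b : Bool) : sgnR b * sgnR b = 1 := by
  cases b <;> simp [sgnR]

/-- Apply `π` (`b = true`) or not. -/
def cimg (g : SgnMap ι) (b : Bool) (t : ι) : ι := bif b then g.π t else t

/-- The integer coefficient of one projector step along a word letter: `bif b then s · ε t else 1`. -/
def ccoef (g : SgnMap ι) (s : ℤ) (b : Bool) (t : ι) : ℤ := bif b then s * g.ε t else 1

section Four

variable (g : Fin 4 → SgnMap ι) (B : ι → ι → ℤ)

/-- The block operator `P_b = (1+s₀g₀)(1+s₁g₁)(1+s₂g₂)(1+s₃g₃)`, `sᵢ = sgnR bᵢ` (nested steps, `g₃` innermost). [folklore] -/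
noncomputable def P4 (b0 b1 b2 b3 : Bool) (x : ι → ℝ) : ι → ℝ :=
  pstep (g 0) (sgnR b0) (pstep (g 1) (sgnR b1) (pstep (g 2) (sgnR b2) (pstep (g 3) (sgnR b3) x)))

/-- Image of the index `t` under the word `w` (letters applied `g₃` first). -/
def Pimg (w0 w1 w2 w3 : Bool) (t : ι) : ι :=
  cimg (g 0) w0 (cimg (g 1) w1 (cimg (g 2) w2 (cimg (g 3) w3 t)))

/-- Coefficient of `e_{Pimg w t}` in `P_b e_t`. -/
def Pcoef (b0 b1 b2 b3 : Bool) (w0 w1 w2 w3 : Bool) (t : ι) : ℤ :=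
  ccoef (g 3) (sgnZ b3) w3 t *
    ccoef (g 2) (sgnZ b2) w2 (cimg (g 3) w3 t) *
    ccoef (g 1) (sgnZ b1) w1 (cimg (g 2) w2 (cimg (g 3) w3 t)) *
    ccoef (g 0) (sgnZ b0) w0 (cimg (g 1) w1 (cimg (g 2) w2 (cimg (g 3) w3 t)))

/-- Explicit sixteen-term sum over the words (kernel-friendly). -/
def wsum (f : Bool → Bool → Bool → Bool → ℤ) : ℤ :=
  f false false false false + f true false false false + f false true false false +
    f true true false false + f false false true false + f true false true false +
    f false true true false + f true true true false + f false false false true +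
    f true false false true + f false true false true + f true true false true +
    f false false true true + f true false true true + f false true true true + f true true true true

/-- `wsum` is the iterated sum over `Bool⁴`. -/
theorem wsum_eq (f : Bool → Bool → Bool → Bool → ℤ) :
    wsum f = ∑ w3, ∑ w2, ∑ w1, ∑ w0, f w0 w1 w2 w3 := by
  simp only [wsum, Fintype.sum_bool]; ring

/-- The BLOCK MATRIX of the sign pattern `b` on representatives `r`:
`C k l = 16 Σ_w Pcoef_b w (r l) · B (r k) (Pimg w (r l)) = 16 Q(e_{r k}, P_b e_{r l})`. [folklore] -/
def blockMat (b0 b1 b2 b3 : Bool) {d : ℕ} (r : Fin d → ι) (k l : Fin d) : ℤ :=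
  16 * wsum fun w0 w1 w2 w3 =>
    Pcoef g b0 b1 b2 b3 w0 w1 w2 w3 (r l) * B (r k) (Pimg g w0 w1 w2 w3 (r l))

variable {g B}

/-! ### Positivity from the sixteen blocks -/

/-- Positivity of `Q` from positivity on the two `g`-blocks (Boolean signs). -/
theorem nonneg_of_splitB {g1 : SgnMap ι} (hg : g1.isInvol = true) (hB : g1.preserves B = true) (x : ι → ℝ)
    (h : ∀ b : Bool, 0 ≤ zform B (pstep g1 (sgnR b) x) (pstep g1 (sgnR b) x)) :
    0 ≤ zform B x x := by
  have h1 := h true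
  have h2 := h false
  change 0 ≤ zform B (pstep g1 1 x) (pstep g1 1 x) at h1
  change 0 ≤ zform B (pstep g1 (-1) x) (pstep g1 (-1) x) at h2
  have := zform_split hg hB x
  linarith

/-- **Positivity from the sixteen symmetry blocks** (no commutation needed): if every `gᵢ` is a
signed involution preserving `B` and `Q(P_b x, P_b x) ≥ 0` for all sign patterns `b` and all `x`,
then `Q ≥ 0`. -/
theorem nonneg_of_blocks4 (hg : ∀ i, (g i).isInvol = true) (hB : ∀ i, (g i).preserves B = true)
    (h : ∀ b0 b1 b2 b3 x, 0 ≤ zform B (P4 g b0 b1 b2 b3 x) (P4 g b0 b1 b2 b3 x))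
    (x : ι → ℝ) : 0 ≤ zform B x x :=
  nonneg_of_splitB (hg 3) (hB 3) x fun b3 =>
    nonneg_of_splitB (hg 2) (hB 2) _ fun b2 =>
      nonneg_of_splitB (hg 1) (hB 1) _ fun b1 =>
        nonneg_of_splitB (hg 0) (hB 0) _ fun b0 => h b0 b1 b2 b3 x

/-! ### Linearity of `P_b` -/

section Lin

variable (b0 b1 b2 b3 : Bool)

omit [Fintype ι] [DecidableEq ι] in
/-- `P_b` is additive. -/
theorem P4_add (x y : ι → ℝ) : P4 g b0 b1 b2 b3 (x + y) = P4 g b0 b1 b2 b3 x + P4 g b0 b1 b2 b3 y := by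
  simp only [P4, pstep_add]

omit [Fintype ι] [DecidableEq ι] in
/-- `P_b` commutes with scalars. -/
theorem P4_smul (c : ℝ) (x : ι → ℝ) : P4 g b0 b1 b2 b3 (c • x) = c • P4 g b0 b1 b2 b3 x := by
  simp only [P4, pstep_smul]

omit [Fintype ι] [DecidableEq ι] in
/-- `P_b` commutes with finite sums. -/
theorem P4_sum {κ : Type*} (S : Finset κ) (x : κ → ι → ℝ) :
    P4 g b0 b1 b2 b3 (∑ j ∈ S, x j) = ∑ j ∈ S, P4 g b0 b1 b2 b3 (x j) := by
  simp only [P4, pstep_sum]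

end Lin

end Four

end SymmetryBlocks

end Summit.Ventures.CertifiedQuantumChemistry
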